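import Literature.NumberTheory.GaloisRepresentations.ContinuousCohomologyIntCoefficients
import HarnessLib

/-!
# `H¹(G, A) = 0` for a compact group acting trivially on a torsion-free discrete group;
# `H¹(G, ℤ) = 0`, `H¹(G, ℚ) = H²(G, ℚ) = 0`

Topic `NumberTheory/GaloisRepresentations`; namespace `Literature.NumberTheory.GaloisRepresentations`.
Theorems only (no definition, no named fact).  Complements of `ContinuousCohomologyBockstein.lean` /
`ContinuousCohomologyIntCoefficients.lean`:

* `subsingleton_continuousCohomology_one_of_trivial_of_torsionFree` — for `G` compact acting
  TRIVIALLY on a discrete torsion-free `A`, `H¹(G, A) = Hom_cont(G, A) = 0` (a class is torsion,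
  `exists_nsmul_one_eq_zero`; for a trivial action `[·]` is injective on cocycles, and `n • φ = 0`
  forces `φ = 0` in a torsion-free group) — "`H¹(G, ℤ) = Hom(G, ℤ) = 0` for profinite `G`"
  [Serre, *Local Fields* XIII §1; Cassels–Fröhlich VI §1.1];
* `subsingleton_continuousCohomology_one_ZCoeff` (`H¹(G, ℤ) = 0`),
  `subsingleton_continuousCohomology_one_QCoeff`, `subsingleton_continuousCohomology_two_QCoeff`
  (`H¹(G, ℚ) = H²(G, ℚ) = 0`, `G` profinite) for the trunk's discrete coefficient models.

Honest framing: classical; nothing here bears on abc or takes a side on [IUTchIII] Cor. 3.12.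
-/

noncomputable section

open CategoryTheory Function

universe u

namespace Literature.NumberTheory.GaloisRepresentations

open _root_.TopRep _root_.ContRepresentation _root_.ContinuousCohomology _root_.Topology

section TorsionFree

variable {G : Type u} [Group G] [TopologicalSpace G] [IsTopologicalGroup G] [CompactSpace G]
variable {A : Type u} [AddCommGroup A] [TopologicalSpace A] [DiscreteTopology A]

/-- **`H¹(G, A) = 0` for a compact group `G` acting trivially on a torsion-free discrete group `A`**
("`Hom_cont(G, ℤ) = 0`": a continuous homomorphism from a compact group to a discrete torsion-free
group is trivial). [cite: SerreLocalFields1979, XIII §1] -/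
theorem subsingleton_continuousCohomology_one_of_trivial_of_torsionFree (ρ : ContinuousRep G ℤ A)
    (htriv : ∀ (g : G) (a : A), ρ g a = a) (htf : ∀ (n : ℕ) (a : A), 0 < n → n • a = 0 → a = 0) :
    Subsingleton (continuousCohomology 1 ρ.toTopRep) := by
  refine ⟨fun x y => ?_⟩
  rw [← sub_eq_zero]
  obtain ⟨φ, hφ⟩ := oneCocycleClass_surjective _ (x - y)
  obtain ⟨n, hn, h⟩ := exists_nsmul_one_eq_zero ρ.toTopRep (x - y)
  -- `[n • φ] = 0`, so `n • φ` is a coboundary, i.e. zero (trivial action)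
  have hnφ : oneCocycleClass _ ((n : ℤ) • φ) = 0 := by
    rw [oneCocycleClass_smul, hφ, Nat.cast_smul_eq_nsmul, h]
  obtain ⟨v, hv⟩ := (oneCocycleClass_eq_zero_iff _ _).1 hnφ
  have hφ0 : φ = 0 := by
    refine Subtype.ext (ContinuousMap.ext fun g => ?_)
    have e : ((n : ℤ) • φ).1 g = ρ.toTopRep.ρ g v - v := hv g
    rw [ContinuousRep.toTopRep_ρ_apply, htriv, sub_self] at e
    have e' : n • φ.1 g = 0 := by
      rw [← Nat.cast_smul_eq_nsmul ℤ]; exact e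
    exact htf n _ hn e'
  rw [← hφ, hφ0, oneCocycleClass_zero]

/-- **`H¹(G, ℤ) = 0` for a compact group `G`** (trivial discrete `ℤ = ZCoeff`).
[cite: SerreLocalFields1979, XIII §1] -/
theorem subsingleton_continuousCohomology_one_ZCoeff :
    Subsingleton (continuousCohomology 1 (ContinuousRep.trivial G ℤ ZCoeff.{u}).toTopRep) :=
  subsingleton_continuousCohomology_one_of_trivial_of_torsionFree _ (fun _ _ => rfl)
    fun n a hn h => by
      apply ULift.down_injective
      have h' : n • a.down = 0 := congrArg ULift.down h
      exact (smul_eq_zero_iff_right (Nat.pos_iff_ne_zero.mp hn)).mp h'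

/-- **`H¹(G, ℚ) = 0` for a compact group `G`** (trivial discrete `ℚ = QCoeff`; uniquely divisible
coefficients). [cite: SerreLocalFields1979, XIII §1] -/
theorem subsingleton_continuousCohomology_one_QCoeff :
    Subsingleton (continuousCohomology 1 (ContinuousRep.trivial G ℤ QCoeff.{u}).toTopRep) :=
  subsingleton_continuousCohomology_one_of_bijective_smul _ QCoeff.bijective_smul

variable [T2Space G] [TotallyDisconnectedSpace G]

/-- **`H²(G, ℚ) = 0` for a profinite group `G`** (trivial discrete `ℚ = QCoeff`).
[cite: SerreLocalFields1979, XIII §1] -/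
theorem subsingleton_continuousCohomology_two_QCoeff :
    Subsingleton (continuousCohomology 2 (ContinuousRep.trivial G ℤ QCoeff.{u}).toTopRep) :=
  subsingleton_continuousCohomology_two_of_bijective_smul _ QCoeff.bijective_smul

end TorsionFree

end Literature.NumberTheory.GaloisRepresentations

end
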